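import Mathlib.NumberTheory.NumberField.AdeleRing
import Mathlib.Topology.Algebra.RestrictedProduct.Basic
import Mathlib.MeasureTheory.Measure.Haar.Basic
import Mathlib.RepresentationTheory.Intertwining
import Mathlib.RepresentationTheory.Irreducible
import Literature.NumberTheory.Automorphic.AdelicGroupData
import Literature.NumberTheory.Automorphic.HilbertRepSpectrum
import Literature.NumberTheory.Automorphic.AutomorphicSpectrum
import Literature.NumberTheory.Automorphic.HeckeAlgebra
import Literature.NumberTheory.Automorphic.MatrixCoefficients
import Literature.NumberTheory.Automorphic.RestrictedTensorProduct
import Literature.NumberTheory.Automorphic.GLnAdelicStructure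
import Literature.NumberTheory.Automorphic.GLnCuspidalSpectrum
import HarnessLib

-- provenance: harness21/H21/H21/Statements/Lang/AutomorphicGLn.lean @ 853bf94 (interim HEAD d8f2665); M5 mechanical rewrite
/-!
# Langlands family (`lang`): cuspidal automorphic representations of `GL_n(𝔸_K)`
(statements **lang.S20**, **lang.S19**, **lang.S36**)

Let `K` be a number field, `n : ℕ`, `𝒢 = AdelicGroupData.gl n K` the honest adelic datum of
`GL_n` (`𝒢.Adelic = GL_n(𝔸_K)`, automorphic quotient `GL_n(𝔸_K) ⧸ A_G GL_n(K)` with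
`A_G = ℝ_{>0}`, outline D10) and `μ` an automorphic measure on the quotient
(`[𝒢.IsAutomorphicMeasure μ]`, outline D11 — every `L²` statement below takes exactly this
instance). This file collects the target statements of the Langlands family about the cuspidal
spectrum `L²_cusp ≤ L²(GL_n(𝔸_K) ⧸ A_G GL_n(K))` (prelude item C13 `GLnCuspidalSpectrum`:
`cuspidalSubspace n K μ`, `CuspidalAutomorphicRepGL n K μ`), phrased with the accepted
AutomorphicAxiomatic prelude (C11 `AutomorphicSpectrum`, C12 `GLnAdelicStructure`,
C14 `RestrictedTensorProduct`, C3 `MatrixCoefficients`, C4 `HeckeAlgebra`,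
`HilbertRepSpectrum`).

* Untagged (review F7a): `cuspidalSubspace_le_discreteSpectrum` and
  `isDiscretelyDecomposable_cuspidal`, the `L²` formulation of cuspidality
  (Gelfand–Graev–Piatetski-Shapiro); restated in `namespace Literature.Lang` and *proved* from the
  prelude theorems of the same name (which are `sorry` there). The analytic notion of lang.S18
  (Borel–Jacquet automorphic forms: smooth, `K`-finite, `𝔷`-finite, of moderate growth) is
  tier L and is not claimed anywhere in this file.
* **lang.S20** (Shalika, Ann. Math. 100 (1974); Piatetski-Shapiro, Corvallis 1979;
  Jacquet–Shalika, Amer. J. Math. 103 (1981), Thm. 4.8). Multiplicity one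
  `multiplicity_one_gl : (cuspidalSubspace n K μ).toContRep.HasMultiplicityOne` and strong
  multiplicity one in two forms: `strong_multiplicity_one_gl` (equality of Satake parameters at
  all `v ∉ S` for a level `Kf` maximal outside `S`, with a non-vacuity guard) and
  `strong_multiplicity_one_gl_of_hasLocalComponentAt` (the same local components at all
  `v ∉ S`).
* **lang.S19** (Flath, Corvallis 1979, Thm. 3), abstract finite-adelic form: for a family of
  locally profinite groups `G i` with compact open subgroups `K i` such that `(G i, K i)` is a
  Gelfand pair for almost all `i` (the hypothesis replacing "reductive + hyperspecial", cf.
  lang.S17 `isGelfandPair_glInt`), every irreducible admissible representation of the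
  restricted product `Πʳ i, [G i, K i]` is a restricted tensor product of irreducible admissible
  representations, almost all spherical (`flath_exists`), and the factors are unique up to
  isomorphism (`flath_unique`).
* **lang.S36** (Langlands, *Problems in the theory of automorphic forms* (1970); Sarnak, *Notes
  on the generalized Ramanujan conjectures*, Clay Math. Proc. 4 (2005)). The generalised
  Ramanujan conjecture for `GL_n` at the finite places, `RamanujanConjectureGL n : Prop`
  (a `def`, never a theorem): Satake parameters of cuspidal `Π` have absolute value `1`, and
  every irreducible admissible local component `Π_v` is tempered.

## Mathlib search

Mathlib (this pin) has `NumberField.AdeleRing`, `IsDedekindDomain.HeightOneSpectrum`,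
`adicCompletion`, `RestrictedProduct` (with its group structure and topology),
`Matrix.GeneralLinearGroup`, `Representation`, `Representation.Equiv`,
`Representation.IsIrreducible`, `Subgroup.center`, `QuotientGroup` topology,
`Measure.IsHaarMeasure`, `MeasureTheory.Lp` with its inner product space structure — all used
below through the prelude. It has no automorphic representations, no cusp forms on adele groups
(its `CuspForm` is the classical holomorphic notion on `ℍ`), no multiplicity one, no restricted
tensor products, no tempered representations and no Ramanujan conjecture (`rg -i ramanujan`
finds only the Chudnovsky–Ramanujan `π` formula and the Ramanujan–Serre derivative of modular
forms; `rg -i 'multiplicity one'`, `rg -i flath`, `rg -i 'restricted tensor'`, `rg IsTempered`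
find nothing). Nothing here duplicates a Mathlib
declaration; this file introduces no new definition except the conjecture statement
`RamanujanConjectureGL`.

## Design choices

* All declarations live in `namespace Literature.Lang`, `open Literature.Automorphic`; every `L²` statement
  takes `[(AdelicGroupData.gl n K).IsAutomorphicMeasure μ]` (outline D11).
* **Levels in Satake-parameter clauses (deviation from the outline sketch, flagged).** The
  outline sketches the level hypothesis of `strong_multiplicity_one_gl` and of the Satake clause
  of `RamanujanConjectureGL` as `IsOpen (Kf : Set GL_n(𝔸_K))`. This is both too strong and too
  weak. Too strong: by the design note of `GLnAdelicStructure` (levels have *trivial*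
  archimedean component; `GL_n(𝔸_K)` has no compact open subgroups) an open `Kf ≤ GL_n(𝔸_K)`
  contains an open subgroup of `GL_n(K_∞)`, so no cuspidal `Π` (`n ≥ 2`) has a non-zero
  `Kf`-fixed vector and both statements would be vacuous. Too weak: `HasSatakeParameterAt W Kf v`
  reads the eigenvalues of the double-coset operators `[Kf t_{v,i} Kf]`, which are the Satake
  eigenvalues `q_v^{i(n-i)/2} e_i(α)` only when `Kf` is `GL_n(𝒪_v)` at `v`; at Iwahori level at
  `v` they are `U_v`-eigenvalues (e.g. `q_v^{1/2} α_1`), producing junk "Satake parameters" of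
  absolute value `≠ 1` for tempered `Π_v`, which would *refute* the literal Ramanujan clause. We
  therefore use the prelude's honest hypothesis `IsMaximalAt n K v Kf` (`GL_n(𝒪_v) ↪ Kf`,
  C12) at the relevant places and drop `IsOpen`. With `GL_n(𝒪_v) ≤ Kf` the map
  `GL_n(𝒪_v) t GL_n(𝒪_v) / GL_n(𝒪_v) → Kf t Kf / Kf` is a bijection whenever `Π^{Kf} ≠ 0`
  (the `v`-projection of `Kf` then lies in `GL_n(𝒪_v) Z(K_v)`, since a non-zero vector of an
  infinite-dimensional unitary `Π_v` cannot be an eigenvector of a non-compact open subgroup of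
  `SL_n(K_v)`), so the Hecke eigenvalues are the local spherical ones and both statements are
  faithful; no openness or compactness of `Kf` is needed for their truth.
* `strong_multiplicity_one_gl` keeps the outline's **non-vacuity guard** `∃ v ∉ S, ∃ ϖ α,
  HasSatakeParameterAt Π.1 Kf v ϖ α` (it forces `Π^{Kf} ≠ 0`; otherwise the `↔` hypothesis holds
  trivially for every `Π'` with `Π'^{Kf} = 0`). The companion
  `strong_multiplicity_one_gl_of_hasLocalComponentAt` is the verbatim "`Π_v ≅ Π'_v` for all
  `v ∉ S`" form, via C12's `HasLocalComponentAt` restricted to irreducible admissible `ρ`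
  (C13's `exists_hasLocalComponentAt` makes it non-vacuous).
* **Flath (lang.S19)** is stated in the abstract form the prelude C14 supports: index type `ι`,
  groups `G i` locally profinite (`NonarchimedeanGroup`, `LocallyCompactSpace`, `T2Space`),
  `K i` compact open, `IsGelfandPair ℂ (G i) (K i)` eventually (Flath's hypothesis
  "`ℋ(G_v, K_v)` commutative for almost all `v`", his Thm. 3), `Π` an irreducible admissible
  representation of `Πʳ i, [G i, K i]` on `W : Type w`; the local spaces are quantified as
  `V : ι → Type w` (same universe as `W`: each `V i` is realised inside `W`, Flath §2). The
  archimedean `(𝔤, K_∞)`-module factor of the inventory text is omitted (notion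
  `archimedean_gK_module`, tier L).
* **Ramanujan (lang.S36).** Unitary normalisation is automatic: `Π` is a subrepresentation of
  `L²(GL_n(𝔸_K) ⧸ A_G GL_n(K))`, hence unitary and trivial on `A_G` (outline D10), so no
  `|det|^{s}` twist ambiguity arises. Archimedean temperedness is omitted (tier L). The
  temperedness clause quantifies the local space over `V : Type` (as C13's
  `exists_hasLocalComponentAt`) and over all Haar measures on `GL_n(K_v) ⧸ Z` (C3's
  `Representation.IsTempered` takes the measure as an argument); it asks `ρ` irreducible *and
  admissible* (C12: `HasLocalComponentAt` is meaningful for irreducible admissible `ρ`; C3: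
  `IsTempered` presupposes smoothness).
* All theorems are known results in print and are `:= by sorry`, except the two untagged
  restatements, which are proved from the prelude.

## References

* J. A. Shalika, *The multiplicity one theorem for `GL_n`*, Ann. of Math. 100 (1974), 171–193.
* I. I. Piatetski-Shapiro, *Multiplicity one theorems*, Proc. Sympos. Pure Math. 33
  (Corvallis 1979), part 1, 209–212.
* H. Jacquet, J. A. Shalika, *On Euler products and the classification of automorphic
  representations II*, Amer. J. Math. 103 (1981), Thm. 4.8.
* D. Flath, *Decomposition of representations into tensor products*, Proc. Sympos. Pure Math.
  33 (Corvallis 1979), part 1, 179–183, Thm. 3.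
* R. P. Langlands, *Problems in the theory of automorphic forms*, LNM 170 (1970).
* P. Sarnak, *Notes on the generalized Ramanujan conjectures*, Clay Math. Proc. 4 (2005).
* I. M. Gelfand, M. I. Graev, I. I. Piatetski-Shapiro, *Representation theory and automorphic
  functions* (1969), Ch. 3.
* A. Borel, H. Jacquet, *Automorphic forms and automorphic representations*, Corvallis (1979),
  part 1, §4.
-/

noncomputable section

open scoped MatrixGroups RestrictedProduct
open NumberField IsDedekindDomain MeasureTheory Filter

namespace Literature.NumberTheory.Automorphic


universe u v w w'

/-! ### The `L²` cuspidal spectrum is discrete (untagged; review F7a) -/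

section Cuspidal

variable (n : ℕ) (K : Type) [Field K] [NumberField K]
  (μ : Measure (AdelicGroupData.gl n K).automorphicQuotient)
  [(AdelicGroupData.gl n K).IsAutomorphicMeasure μ]

/-- **Gelfand–Piatetski-Shapiro** (`L²` formulation of cuspidality). The cuspidal subspace
`L²_cusp(GL_n(𝔸_K) ⧸ A_G GL_n(K))` is contained in the discrete spectrum `L²_disc`, i.e. it
decomposes as a Hilbert direct sum of irreducible representations with finite multiplicities
(Gelfand–Graev–Piatetski-Shapiro (1969), Ch. 3; Godement, Proc. Sympos. Pure Math. 9 (1966),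
§3; Borel–Jacquet (1979), §4.6). L² formulation of cuspidality (Gelfand–Graev–Piatetski-Shapiro);
the analytic notion of lang.S18 is not claimed. Proved from the prelude theorem
`Literature.NumberTheory.Automorphic.GLnCuspidalSpectrum.cuspidalSubspace_le_discreteSpectrum`. [cite: GelfandGraevPiatetskiShapiro1969] -/
def AutomorphicGLn.cuspidalSubspace_le_discreteSpectrum : Prop :=
  cuspidalSubspace n K μ ≤ (AdelicGroupData.gl n K).discreteSpectrum μ

/- interim proof relied on results that are now named facts (D-0014); demoted to a fact by the M5 import, proof preserved:
:=
  Literature.Automorphic.cuspidalSubspace_le_discreteSpectrum n K μ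
-/

/-- **Discrete decomposability of `L²_cusp`** (`L²` formulation of cuspidality). The regular
representation of `GL_n(𝔸_K)` on `L²_cusp(GL_n(𝔸_K) ⧸ A_G GL_n(K))` is the closed span of its
irreducible closed subrepresentations (Gelfand–Graev–Piatetski-Shapiro (1969), Ch. 3;
Borel–Jacquet (1979), §4.6). L² formulation of cuspidality (Gelfand–Graev–Piatetski-Shapiro);
the analytic notion of lang.S18 is not claimed. Proved from the prelude theorem
`Literature.NumberTheory.Automorphic.GLnCuspidalSpectrum.isDiscretelyDecomposable_cuspidal`. [cite: GelfandGraevPiatetskiShapiro1969] -/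
def AutomorphicGLn.isDiscretelyDecomposable_cuspidal : Prop :=
  (cuspidalSubspace n K μ).toContRep.IsDiscretelyDecomposable

/- interim proof relied on results that are now named facts (D-0014); demoted to a fact by the M5 import, proof preserved:
:=
  Literature.Automorphic.isDiscretelyDecomposable_cuspidal n K μ
-/

end Cuspidal

/-! ### lang.S20: multiplicity one and strong multiplicity one for `GL_n` -/

section MultiplicityOne

variable (n : ℕ) (K : Type) [Field K] [NumberField K]
  (μ : Measure (AdelicGroupData.gl n K).automorphicQuotient)
  [(AdelicGroupData.gl n K).IsAutomorphicMeasure μ]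

/-- **lang.S20** (multiplicity one for `GL_n`; Shalika, Ann. of Math. 100 (1974), Thm. 5.5;
Piatetski-Shapiro, *Multiplicity one theorems*, Corvallis (1979); Jacquet–Shalika, Amer. J.
Math. 103 (1981)). The cuspidal spectrum `L²_cusp(GL_n(𝔸_K) ⧸ A_G GL_n(K))` has multiplicity
one: two topologically irreducible closed `GL_n(𝔸_K)`-invariant subspaces of `L²_cusp` that are
unitarily equivalent coincide (`ContRepresentation.HasMultiplicityOne`), i.e. every cuspidal
automorphic representation of `GL_n(𝔸_K)` occurs in `L²_cusp` exactly once. [cite: Corvallis1979] -/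
def multiplicity_one_gl : Prop :=
  (cuspidalSubspace n K μ).toContRep.HasMultiplicityOne

variable {n K μ}

/-- **lang.S20** (strong multiplicity one for `GL_n`, Satake-parameter form; Piatetski-Shapiro,
Corvallis (1979); Jacquet–Shalika, Amer. J. Math. 103 (1981), Thm. 4.8). Let `Π, Π'` (`P P'`
in code; `Π` is a Lean keyword) be cuspidal automorphic representations of `GL_n(𝔸_K)`, `S` a finite set of finite places and
`Kf ≤ GL_n(𝔸_K)` a level subgroup which is `GL_n(𝒪_v)` at every `v ∉ S` (`IsMaximalAt`, so that
the double-coset operators `[Kf t_{v,i} Kf]` on `Kf`-fixed vectors are the spherical Hecke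
operators at `v`). If `Π` has a `Kf`-fixed Hecke eigenvector at some `v ∉ S` (non-vacuity guard:
in particular `Π^{Kf} ≠ 0`) and `Π, Π'` have the same Satake parameters with respect to `Kf` at
every `v ∉ S` — i.e. `Π_v ≅ Π'_v` for all `v ∉ S`, both being unramified there with the same
Satake parameter — then `Π = Π'` as subspaces of `L²_cusp` (Jacquet–Shalika give `Π ≅ Π'`;
equality follows from multiplicity one, `multiplicity_one_gl`). The outline's hypothesis
`IsOpen Kf` is replaced by `IsMaximalAt` (see the module docstring: open levels in `GL_n(𝔸_K)`
have no cuspidal fixed vectors, and non-maximal levels at `v` give `U_v`- rather than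
`T_v`-eigenvalues). [cite: Corvallis1979] -/
def strong_multiplicity_one_gl : Prop :=
  ∀ (P P' : CuspidalAutomorphicRepGL n K μ) (S : Finset (HeightOneSpectrum (𝓞 K))) (Kf : Subgroup (AdelicGroupData.gl n K).Adelic) (hKf : ∀ v ∉ S, IsMaximalAt n K v Kf) (h : ∀ v ∉ S, ∀ (ϖ : (v.adicCompletion K)ˣ) (α : Multiset ℂ), HasSatakeParameterAt P.1 Kf v ϖ α ↔ HasSatakeParameterAt P'.1 Kf v ϖ α) (h₀ : ∃ v ∉ S, ∃ (ϖ : (v.adicCompletion K)ˣ) (α : Multiset ℂ), HasSatakeParameterAt P.1 Kf v ϖ α),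
    P = P'

/-- **lang.S20** (strong multiplicity one for `GL_n`, local-component form; Jacquet–Shalika,
Amer. J. Math. 103 (1981), Thm. 4.8; Piatetski-Shapiro, Corvallis (1979)). If two cuspidal
automorphic representations `Π, Π'` of `GL_n(𝔸_K)` have the same irreducible admissible local
components `Π_v ≅ Π'_v` (C12 `HasLocalComponentAt`, along `GL_n(K_v) ↪ GL_n(𝔸_K)`) at all finite
places `v` outside a finite set `S`, then `Π = Π'` in `L²_cusp` (isomorphism by Jacquet–Shalika,
equality by multiplicity one). Non-vacuous: every `Π` has an irreducible admissible local
component at every `v` (C13 `exists_hasLocalComponentAt`), unique up to isomorphism. The local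
spaces are quantified over `V : Type`, as in C13. [cite: Corvallis1979] -/
def strong_multiplicity_one_gl_of_hasLocalComponentAt : Prop :=
  ∀ (P P' : CuspidalAutomorphicRepGL n K μ) (S : Finset (HeightOneSpectrum (𝓞 K))) (h : ∀ v ∉ S, ∀ (V : Type) [AddCommGroup V] [Module ℂ V] (ρ : Representation ℂ (GL (Fin n) (v.adicCompletion K)) V), ρ.IsIrreducible → ρ.IsAdmissible → (HasLocalComponentAt P.1 v ρ ↔ HasLocalComponentAt P'.1 v ρ)),
    P = P'

end MultiplicityOne

/-! ### lang.S19: Flath's tensor product theorem (abstract finite-adelic form) -/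

section Flath

variable {ι : Type u} [DecidableEq ι] {G : ι → Type v} [∀ i, Group (G i)]
  [∀ i, TopologicalSpace (G i)] [∀ i, NonarchimedeanGroup (G i)]
  [∀ i, LocallyCompactSpace (G i)] [∀ i, T2Space (G i)] {K : ∀ i, Subgroup (G i)}
  {W : Type w} [AddCommGroup W] [Module ℂ W]

/-- **lang.S19** (Flath's tensor product theorem, existence; Flath, *Decomposition of
representations into tensor products*, Corvallis (1979), Thm. 3 with Thm. 2 and Example 2;
Bump, *Automorphic forms and representations*, Thm. 3.4.4 ff.). Let `(G i)_{i ∈ ι}` be locally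
profinite groups with compact open subgroups `K i` such that the Hecke algebra `ℋ(G i, K i)` is
commutative (`IsGelfandPair`) for all but finitely many `i` (for `G i = 𝐆(K_v)` reductive and
`K i` hyperspecial this is the Satake isomorphism, lang.S17). Then every irreducible admissible
representation `π` of the restricted product `G = Πʳ i, [G i, K i]` is a restricted tensor
product `π ≅ ⊗'_i (ρ i, x₀ i)` (C14 `IsRestrictedTensorProductRep`) of irreducible admissible
representations `ρ i` of the `G i`, with `ρ i` spherical (`dim (V i)^{K i} = 1`) and `x₀ i` a
non-zero `K i`-fixed vector for almost all `i`. The local spaces `V i` are taken in the universe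
of `W` (each is realised inside `W`). The archimedean `(𝔤, K_∞)`-factor of the inventory text is
omitted (tier L). [cite: Corvallis1979] -/
def flath_exists : Prop :=
  ∀ (hK : ∀ i, IsOpen (K i : Set (G i))) (hKc : ∀ i, IsCompact (K i : Set (G i))) (hGP : ∀ᶠ i in cofinite, IsGelfandPair ℂ (G i) (K i)) (π : Representation ℂ (Πʳ i, [G i, K i]) W) (hirr : π.IsIrreducible) (hadm : π.IsAdmissible),
    ∃ (V : ι → Type w) (_ : ∀ i, AddCommGroup (V i)) (_ : ∀ i, Module ℂ (V i))
      (ρ : ∀ i, Representation ℂ (G i) (V i)) (x₀ : ∀ i, V i)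
      (hx₀ : ∀ᶠ i in cofinite, x₀ i ∈ (ρ i).fixedPoints (K i))
      (j : RestrictedFamily V x₀ → W) (S₀ : Finset ι),
      IsRestrictedTensorProductRep ρ π hx₀ j S₀ ∧
        (∀ i, (ρ i).IsIrreducible ∧ (ρ i).IsAdmissible) ∧
        ∀ᶠ i in cofinite, (ρ i).IsSpherical (K i) ∧ x₀ i ≠ 0

/-- **lang.S19** (Flath's tensor product theorem, uniqueness of the local factors; Flath,
Corvallis (1979), Thm. 3; Bump, Thm. 3.4.4 ff.). Under the hypotheses of `flath_exists`, if an
irreducible admissible `π` of `Πʳ i, [G i, K i]` is a restricted tensor product of irreducible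
admissible `ρ i` (on spaces `V i`) and also of irreducible admissible `ρ' i` (on spaces `V' i`),
possibly with different base vectors and exceptional sets, then `ρ i ≅ ρ' i` for every `i`
(Mathlib `Representation.Equiv`). [cite: Corvallis1979] -/
def flath_unique : Prop :=
  ∀ (hK : ∀ i, IsOpen (K i : Set (G i))) (hKc : ∀ i, IsCompact (K i : Set (G i))) (hGP : ∀ᶠ i in cofinite, IsGelfandPair ℂ (G i) (K i)) (π : Representation ℂ (Πʳ i, [G i, K i]) W) (hirr : π.IsIrreducible) (hadm : π.IsAdmissible) {V : ι → Type w} [∀ i, AddCommGroup (V i)] [∀ i, Module ℂ (V i)] {ρ : ∀ i, Representation ℂ (G i) (V i)} {x₀ : ∀ i, V i} {hx₀ : ∀ᶠ i in cofinite, x₀ i ∈ (ρ i).fixedPoints (K i)} {j : RestrictedFamily V x₀ → W} {S₀ : Finset ι} {V' : ι → Type w'} [∀ i, AddCommGroup (V' i)] [∀ i, Module ℂ (V' i)] {ρ' : ∀ i, Representation ℂ (G i) (V' i)} {x₀' : ∀ i, V' i} {hx₀' : ∀ᶠ i in cofinite, x₀' i ∈ (ρ' i).fixedPoints (K i)} {j'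 : RestrictedFamily V' x₀' → W} {S₀' : Finset ι} (h : IsRestrictedTensorProductRep ρ π hx₀ j S₀) (hρ : ∀ i, (ρ i).IsIrreducible ∧ (ρ i).IsAdmissible) (h' : IsRestrictedTensorProductRep ρ' π hx₀' j' S₀') (hρ' : ∀ i, (ρ' i).IsIrreducible ∧ (ρ' i).IsAdmissible) (i : ι),
    Nonempty ((ρ i).Equiv (ρ' i))

end Flath

/-! ### lang.S36: the generalised Ramanujan conjecture for `GL_n` (finite places) -/

section Ramanujan

/-- **lang.S36** (generalised Ramanujan conjecture for `GL_n`; Langlands, *Problems in the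
theory of automorphic forms*, LNM 170 (1970); Sarnak, *Notes on the generalized Ramanujan
conjectures*, Clay Math. Proc. 4 (2005), Conj. p. 659; for `n = 2`, `K = ℚ` and holomorphic
`Π_∞` this is Deligne's theorem, in general OPEN — a `def`, never a theorem). For every number
field `K`, every automorphic measure `μ` and every cuspidal automorphic representation `Π` of
`GL_n(𝔸_K)` (a subrepresentation of `L²(GL_n(𝔸_K) ⧸ A_G GL_n(K))`, hence unitary and trivial
on `A_G = ℝ_{>0}`: the unitary normalisation of the conjecture is automatic, outline D10):
(i) at every finite place `v` at which a level `Kf ⊇ GL_n(𝒪_v)` (`IsMaximalAt`) carries a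
`Kf`-fixed Hecke eigenvector of `Π` with Satake parameter `α = {α_1, …, α_n}`, all `|α_j| = 1`;
(ii) at every finite place `v`, every irreducible admissible local component `Π_v` of `Π`
(C12 `HasLocalComponentAt`, local space `V : Type`) is tempered (C3 `Representation.IsTempered`:
matrix coefficients in `L^{2+ε}(GL_n(K_v) ⧸ Z)` for every Haar measure on `GL_n(K_v) ⧸ Z` and
every `ε > 0`). Archimedean temperedness (Selberg's `1/4` for `n = 2`) is omitted (tier L). The
outline's `IsOpen Kf` in (i) is replaced by `IsMaximalAt n K v Kf` (module docstring: with a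
non-maximal level at `v` the clause would read `U_v`-eigenvalues and be false). [folklore] -/
def RamanujanConjectureGL (n : ℕ) : Prop :=
  ∀ (K : Type) [Field K] [NumberField K]
    (μ : Measure (AdelicGroupData.gl n K).automorphicQuotient)
    [(AdelicGroupData.gl n K).IsAutomorphicMeasure μ] (P : CuspidalAutomorphicRepGL n K μ),
    (∀ (Kf : Subgroup (AdelicGroupData.gl n K).Adelic) (v : HeightOneSpectrum (𝓞 K))
        (ϖ : (v.adicCompletion K)ˣ) (α : Multiset ℂ),
        IsMaximalAt n K v Kf → HasSatakeParameterAt P.1 Kf v ϖ α → ∀ a ∈ α, ‖a‖ = 1) ∧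
      ∀ (v : HeightOneSpectrum (𝓞 K)) (V : Type) [AddCommGroup V] [Module ℂ V]
        (ρ : Representation ℂ (GL (Fin n) (v.adicCompletion K)) V)
        [MeasurableSpace (GL (Fin n) (v.adicCompletion K) ⧸
          Subgroup.center (GL (Fin n) (v.adicCompletion K)))]
        [BorelSpace (GL (Fin n) (v.adicCompletion K) ⧸
          Subgroup.center (GL (Fin n) (v.adicCompletion K)))]
        (ν : Measure (GL (Fin n) (v.adicCompletion K) ⧸
          Subgroup.center (GL (Fin n) (v.adicCompletion K)))) [ν.IsHaarMeasure],
        ρ.IsIrreducible → ρ.IsAdmissible → HasLocalComponentAt P.1 v ρ → ρ.IsTempered ν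

end Ramanujan

end Literature.NumberTheory.Automorphic
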